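import Mathlib.LinearAlgebra.Matrix.PosDef
import Mathlib.MeasureTheory.Integral.Bochner.Basic
import Summits.Ventures.YMGap.FlowData.RitzDeflationCertificate
import Summits.Ventures.YMGap.FlowData.RelativeBracketCertificate
import HarnessLib

/-!
# Venture YMGap, track Y3 FLOW-DATA — Galerkin WEIGHT MATRICES are Loewner-monotone in the weight (the sandwich `G⁻ ⪯ G_S ⪯ G⁺`)

HONEST FRAMING: venture file of the cell `pub-ymgap` (QuantumFields programme), track Y3, lineage A (seat flow-eng-1).  Pure
measure-theoretic linear algebra; NO lattice statement, no number, nothing about limits or a mass gap.  For ANY finite family of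
real test functions `ψ_i` on any measure space and any weight `h`, the Galerkin matrix `M(h)_{ij} = ∫ h ψ_i ψ_j dμ` satisfies
`vᵀ M(h) v = ∫ h (Σ_i v_i ψ_i)² dμ`, hence `h ≥ 0 ⇒ M(h) ⪰ 0` and `f ≤ g ⇒ M(g) − M(f) ⪰ 0`, also after any congruence `Dᴴ · D`.
This is the sentence behind the hypotheses `hlo` / `hhi` of `RitzDeflation.eigenvalues₀_sandwich`, `hrel_lo` / `hrel_hi` of
`RelativeBracket.bracket1_block_enclosure` and `hdom` / `hVΩ` of the `RelativeKineticTail` certificate (ENGINE.md §3 (ii), §8 (ii), §9.2, §10):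
with the pointwise bracket `Π(w̄_N − τ) ≤ Π w̄ ≤ Π(w̄_N + τ)` of `PlaquetteCharacterTail.prod_normWeight_mem_Icc` it yields the
Loewner sandwich of the kept-set Galerkin matrices of the spin-network basis (real orthonormal functions on `SU(2)^{links}`).

* `weightMatrix`, `dotProduct_weightMatrix_mulVec`, `posSemidef_weightMatrix`, `weightMatrix_sub`,
  **`posSemidef_weightMatrix_sub`**, `posSemidef_conj_weightMatrix_sub`.
* v2 (assembly): `weightMatrix_smul`, `sandwich_loewner_hypotheses`, `bracket1_loewner_hypotheses` — the pointwise brackets of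
  `PlaquetteCharacterTail` / `Tail2ProductRemainder` / `Bracket1Pointwise` turned into the PSD hypotheses of `RitzDeflation.eigenvalues₀_sandwich`
  and `RelativeBracket.eigenvalues₀_bracket1` (any test family, any measure, any congruence), and the eigenvalue-level consequence
  `eigenvalues₀_sandwich_of_pointwise` (imports `RitzDeflationCertificate`); `RelativeBracket.eigenvalues₀_bracket1` consumes
  `bracket1_loewner_hypotheses` verbatim (not restated here: that module's olean was not built at filing time);
  v3 (flow-eng-1 g9): `eigenvalues₀_bracket1_of_pointwise` — that consumption as a theorem here, now importing
  `RelativeBracketCertificate`: `(1 − X)·λ↓ᵢ(G₁) ≤ λ↓ᵢ(G) ≤ (1 − X)⁻¹·λ↓ᵢ(G₁)` from the pointwise BRACKET-1 chain;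
  `posSemidef_smul_one_sub_weightMatrix` — the peak hypothesis `Ω•1 − V ⪰ 0` of `KWeightTail` / `RelativeKineticTail` from `h ≤ Ω`
  pointwise and an orthonormal test family.

References: R. A. Horn, C. R. Johnson, *Matrix Analysis* (2013), §7.7 (Loewner order, congruence) [cite: HornJohnson2013, §7.7].
-/

noncomputable section

open scoped BigOperators
open MeasureTheory Matrix Finset

namespace Summit.Ventures.YMGap.FlowData.GalerkinWeightMonotone

variable {κ Ω : Type*} [MeasurableSpace Ω]


/-- The weight (Galerkin) matrix `M(h)_{ij} = ∫ h ψ_i ψ_j dμ` of a finite family of real test functions `ψ_i` against a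
weight `h` (ENGINE.md §3/§8: the kept-set Galerkin matrix of the multiplication operator by the plaquette product, in the
spin-network basis). [cite: HornJohnson2013, §7.7] -/
def weightMatrix (μ : Measure Ω) (ψ : κ → Ω → ℝ) (h : Ω → ℝ) : Matrix κ κ ℝ :=
  Matrix.of fun i j => ∫ x, h x * (ψ i x * ψ j x) ∂μ

/-- Entries of the weight matrix. [folklore] -/
theorem weightMatrix_apply (μ : Measure Ω) (ψ : κ → Ω → ℝ) (h : Ω → ℝ) (i j : κ) :
    weightMatrix μ ψ h i j = ∫ x, h x * (ψ i x * ψ j x) ∂μ := rfl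

/-- The weight matrix is symmetric. [folklore] -/
theorem isHermitian_weightMatrix (μ : Measure Ω) (ψ : κ → Ω → ℝ) (h : Ω → ℝ) :
    (weightMatrix μ ψ h).IsHermitian := by
  ext i j
  simp only [Matrix.conjTranspose_apply, weightMatrix_apply, star_trivial, mul_comm (ψ j _) (ψ i _)]

/-- The quadratic form of the weight matrix is the weighted integral of a square:
`vᵀ M(h) v = ∫ h (Σ_i v_i ψ_i)² dμ`. [folklore] -/
theorem dotProduct_weightMatrix_mulVec [Fintype κ] {μ : Measure Ω} {ψ : κ → Ω → ℝ} {h : Ω → ℝ}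
    (hint : ∀ i j, Integrable (fun x => h x * (ψ i x * ψ j x)) μ) (v : κ → ℝ) :
    v ⬝ᵥ (weightMatrix μ ψ h *ᵥ v) = ∫ x, h x * (∑ i, v i * ψ i x) ^ 2 ∂μ := by
  have hij : ∀ i j, Integrable (fun x => v i * (h x * (ψ i x * ψ j x)) * v j) μ :=
    fun i j => ((hint i j).const_mul (v i)).mul_const (v j)
  have hrow : ∀ i, Integrable (fun x => ∑ j, v i * (h x * (ψ i x * ψ j x)) * v j) μ :=
    fun i => integrable_finsetSum _ fun j _ => hij i j
  calc v ⬝ᵥ (weightMatrix μ ψ h *ᵥ v) = ∑ i, ∑ j, ∫ x, v i * (h x * (ψ i x * ψ j x)) * v j ∂μ := by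
        simp only [dotProduct, Matrix.mulVec, weightMatrix, Matrix.of_apply, Finset.mul_sum]
        refine Finset.sum_congr rfl fun i _ => Finset.sum_congr rfl fun j _ => ?_
        rw [← integral_mul_const, ← integral_const_mul]
        exact integral_congr_ae (Filter.Eventually.of_forall fun x => by ring)
    _ = ∑ i, ∫ x, ∑ j, v i * (h x * (ψ i x * ψ j x)) * v j ∂μ :=
        Finset.sum_congr rfl fun i _ => (integral_finsetSum _ fun j _ => hij i j).symm
    _ = ∫ x, ∑ i, ∑ j, v i * (h x * (ψ i x * ψ j x)) * v j ∂μ := (integral_finsetSum _ fun i _ => hrow i).symm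
    _ = ∫ x, h x * (∑ i, v i * ψ i x) ^ 2 ∂μ := by
        refine integral_congr_ae (Filter.Eventually.of_forall fun x => ?_)
        show ∑ i, ∑ j, v i * (h x * (ψ i x * ψ j x)) * v j = h x * (∑ i, v i * ψ i x) ^ 2
        rw [sq, Finset.sum_mul_sum, Finset.mul_sum]
        refine Finset.sum_congr rfl fun i _ => ?_
        rw [Finset.mul_sum]
        refine Finset.sum_congr rfl fun j _ => ?_
        ring

/-- **A non-negative weight gives a positive semidefinite weight matrix.** [folklore] -/
theorem posSemidef_weightMatrix [Fintype κ] {μ : Measure Ω} {ψ : κ → Ω → ℝ} {h : Ω → ℝ} (hh : ∀ x, 0 ≤ h x)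
    (hint : ∀ i j, Integrable (fun x => h x * (ψ i x * ψ j x)) μ) : (weightMatrix μ ψ h).PosSemidef :=
  Matrix.PosSemidef.of_dotProduct_mulVec_nonneg (isHermitian_weightMatrix μ ψ h) fun v => by
    rw [star_trivial, dotProduct_weightMatrix_mulVec hint v]
    exact integral_nonneg fun x => mul_nonneg (hh x) (sq_nonneg _)

/-- The weight matrix is additive in the weight: `M(g) − M(f) = M(g − f)`. [folklore] -/
theorem weightMatrix_sub {μ : Measure Ω} {ψ : κ → Ω → ℝ} {f g : Ω → ℝ}
    (hf : ∀ i j, Integrable (fun x => f x * (ψ i x * ψ j x)) μ) (hg : ∀ i j, Integrable (fun x => g x * (ψ i x * ψ j x)) μ) :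
    weightMatrix μ ψ g - weightMatrix μ ψ f = weightMatrix μ ψ (fun x => g x - f x) := by
  ext i j
  simp only [Matrix.sub_apply, weightMatrix_apply]
  rw [← integral_sub (hg i j) (hf i j)]
  refine integral_congr_ae (Filter.Eventually.of_forall fun x => ?_)
  simp only [sub_mul]

/-- **Loewner monotonicity of the Galerkin matrix in the weight** (the sentence behind the hypotheses `hrel_lo` /
`hrel_hi` of `RitzDeflation.eigenvalues₀_sandwich` and `RelativeBracket.bracket1_block_enclosure`): `f ≤ g` pointwise ⇒
`M(g) − M(f) ⪰ 0`; with `prod_normWeight_mem_Icc` (pointwise `Π(w̄_N − τ) ≤ Π w̄ ≤ Π(w̄_N + τ)`) this is the bracket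
`G⁻ ⪯ G_S ⪯ G⁺` of ENGINE.md §3 (ii), for any finite test family and any measure. [folklore] -/
theorem posSemidef_weightMatrix_sub [Fintype κ] {μ : Measure Ω} {ψ : κ → Ω → ℝ} {f g : Ω → ℝ} (hfg : ∀ x, f x ≤ g x)
    (hf : ∀ i j, Integrable (fun x => f x * (ψ i x * ψ j x)) μ) (hg : ∀ i j, Integrable (fun x => g x * (ψ i x * ψ j x)) μ) :
    (weightMatrix μ ψ g - weightMatrix μ ψ f).PosSemidef := by
  rw [weightMatrix_sub hf hg]
  refine posSemidef_weightMatrix (fun x => sub_nonneg.2 (hfg x)) fun i j => ?_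
  have := (hg i j).sub (hf i j)
  refine this.congr (Filter.Eventually.of_forall fun x => ?_)
  simp only [Pi.sub_apply, sub_mul]

/-- Congruence preserves the order: `M(g) − M(f) ⪰ 0 ⇒ Dᵀ M(g) D − Dᵀ M(f) D ⪰ 0` for any matrix `D` (the `K^½`
factors of `T = K^½ W K^½`, ENGINE.md §3). [folklore] -/
theorem posSemidef_conj_weightMatrix_sub [Fintype κ] {m : Type*} [Fintype m] {μ : Measure Ω} {ψ : κ → Ω → ℝ} {f g : Ω → ℝ}
    (hfg : ∀ x, f x ≤ g x) (hf : ∀ i j, Integrable (fun x => f x * (ψ i x * ψ j x)) μ)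
    (hg : ∀ i j, Integrable (fun x => g x * (ψ i x * ψ j x)) μ) (D : Matrix κ m ℝ) :
    (Dᴴ * weightMatrix μ ψ g * D - Dᴴ * weightMatrix μ ψ f * D).PosSemidef := by
  rw [← Matrix.sub_mul, ← Matrix.mul_sub]
  exact (posSemidef_weightMatrix_sub hfg hf hg).conjTranspose_mul_mul_same D

/-! ### Assembly (flow-eng-1 g8, v2 APPEND): the pointwise plaquette brackets ⇒ the Loewner hypotheses of the certificates

`Bracket1Pointwise.bracket1_pointwise_chain` (ENGINE.md §9.2), `Tail2ProductRemainder.prod_weight_mem_Icc_W1` (§6.1) and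
`PlaquetteCharacterTail.prod_normWeight_mem_Icc` (§3 (ii)) give POINTWISE inequalities between the true plaquette-product weight and
built / bracketing weights, as functions of the link configuration.  The two theorems below only COMPOSE them with
`posSemidef_conj_weightMatrix_sub` into the exact hypothesis shapes of the tree certificates, for any finite real test family, any
measure and any congruence `D` (the `K^½` factors): `sandwich_loewner_hypotheses` = the two PSD facts of
`RitzDeflation.eigenvalues₀_sandwich`; `bracket1_loewner_hypotheses` = `hrel_lo`/`hlo`/`hhi`/`hrel_hi` of
`RelativeBracket.eigenvalues₀_bracket1` / `bracket1_block_enclosure`.  What stays an input: that the engine's float matrices are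
(entrywise within `errG` of) these Galerkin matrices in the spin-network basis (ENGINE.md §8). -/

/-- `M(c·h) = c • M(h)`. [folklore] -/
theorem weightMatrix_smul (μ : Measure Ω) (ψ : κ → Ω → ℝ) (h : Ω → ℝ) (c : ℝ) :
    weightMatrix μ ψ (fun x => c * h x) = c • weightMatrix μ ψ h := by
  ext i j
  simp only [weightMatrix_apply, Matrix.smul_apply, smul_eq_mul, mul_assoc, integral_const_mul]

/-- Integrability of `(c·h) ψ_i ψ_j` from that of `h ψ_i ψ_j`. [folklore] -/
theorem integrable_smul_weight {μ : Measure Ω} {ψ : κ → Ω → ℝ} {h : Ω → ℝ}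
    (hint : ∀ i j, Integrable (fun x => h x * (ψ i x * ψ j x)) μ) (c : ℝ) (i j : κ) :
    Integrable (fun x => c * h x * (ψ i x * ψ j x)) μ := by
  have := (hint i j).const_mul c
  refine this.congr (Filter.Eventually.of_forall fun x => ?_)
  simp only [mul_assoc]

/-- ★ **The sandwich hypotheses** of `RitzDeflation.eigenvalues₀_sandwich` from a pointwise bracket `lo ≤ h ≤ hi` (two-build bracket
of ENGINE.md §3 (ii) via `PlaquetteCharacterTail.prod_normWeight_mem_Icc`, or TAIL-2's `W₁ ∓ F` via
`Tail2ProductRemainder.prod_weight_mem_Icc_W1`), for any finite real test family, any measure and any congruence `D`. [cite: HornJohnson2013, §7.7] -/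
theorem sandwich_loewner_hypotheses [Fintype κ] {m : Type*} [Fintype m] {μ : Measure Ω} {ψ : κ → Ω → ℝ}
    {lo h hi : Ω → ℝ} (hbr : ∀ x, lo x ≤ h x ∧ h x ≤ hi x)
    (hlo : ∀ i j, Integrable (fun x => lo x * (ψ i x * ψ j x)) μ) (hh : ∀ i j, Integrable (fun x => h x * (ψ i x * ψ j x)) μ)
    (hhi : ∀ i j, Integrable (fun x => hi x * (ψ i x * ψ j x)) μ) (D : Matrix κ m ℝ) :
    (Dᴴ * weightMatrix μ ψ h * D - Dᴴ * weightMatrix μ ψ lo * D).PosSemidef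
      ∧ (Dᴴ * weightMatrix μ ψ hi * D - Dᴴ * weightMatrix μ ψ h * D).PosSemidef :=
  ⟨posSemidef_conj_weightMatrix_sub (fun x => (hbr x).1) hlo hh D,
    posSemidef_conj_weightMatrix_sub (fun x => (hbr x).2) hh hhi D⟩

/-- ★ **The BRACKET-1 hypotheses** `hrel_lo`, `hlo`, `hhi`, `hrel_hi` of `RelativeBracket.eigenvalues₀_bracket1` /
`bracket1_block_enclosure`, from the pointwise chain of `Bracket1Pointwise.bracket1_pointwise_chain`
(`(1−X) h₁ ≤ hm ≤ h ≤ hp`, `(1−X) hp ≤ h₁` at every configuration, `X < 1`), for any finite real test family, any measure and any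
congruence `D` (`G₁ = DᴴM(h₁)D`, `Gm = DᴴM(hm)D`, `G = DᴴM(h)D`, `Gp = DᴴM(hp)D`). [cite: HornJohnson2013, §7.7] -/
theorem bracket1_loewner_hypotheses [Fintype κ] {m : Type*} [Fintype m] {μ : Measure Ω} {ψ : κ → Ω → ℝ}
    {h₁ hm h hp : Ω → ℝ} {X : ℝ} (hX : X < 1)
    (hchain : ∀ x, (1 - X) * h₁ x ≤ hm x ∧ hm x ≤ h x ∧ h x ≤ hp x ∧ (1 - X) * hp x ≤ h₁ x)
    (i₁ : ∀ i j, Integrable (fun x => h₁ x * (ψ i x * ψ j x)) μ) (im : ∀ i j, Integrable (fun x => hm x * (ψ i x * ψ j x)) μ)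
    (ih : ∀ i j, Integrable (fun x => h x * (ψ i x * ψ j x)) μ) (ip : ∀ i j, Integrable (fun x => hp x * (ψ i x * ψ j x)) μ)
    (D : Matrix κ m ℝ) :
    (Dᴴ * weightMatrix μ ψ hm * D - (1 - X) • (Dᴴ * weightMatrix μ ψ h₁ * D)).PosSemidef
      ∧ (Dᴴ * weightMatrix μ ψ h * D - Dᴴ * weightMatrix μ ψ hm * D).PosSemidef
      ∧ (Dᴴ * weightMatrix μ ψ hp * D - Dᴴ * weightMatrix μ ψ h * D).PosSemidef
      ∧ ((1 - X)⁻¹ • (Dᴴ * weightMatrix μ ψ h₁ * D) - Dᴴ * weightMatrix μ ψ hp * D).PosSemidef := by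
  have h1X : 0 < 1 - X := by linarith
  -- (1 − X) h₁ ≤ hm
  have A : (Dᴴ * weightMatrix μ ψ hm * D - Dᴴ * weightMatrix μ ψ (fun x => (1 - X) * h₁ x) * D).PosSemidef :=
    posSemidef_conj_weightMatrix_sub (fun x => (hchain x).1) (integrable_smul_weight i₁ (1 - X)) im D
  -- hp ≤ (1 − X)⁻¹ h₁
  have B : (Dᴴ * weightMatrix μ ψ (fun x => (1 - X)⁻¹ * h₁ x) * D - Dᴴ * weightMatrix μ ψ hp * D).PosSemidef := by
    refine posSemidef_conj_weightMatrix_sub (fun x => ?_) ip (integrable_smul_weight i₁ (1 - X)⁻¹) D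
    rw [le_inv_mul_iff₀ h1X]
    exact (hchain x).2.2.2
  rw [weightMatrix_smul, Matrix.mul_smul, Matrix.smul_mul] at A B
  exact ⟨A, posSemidef_conj_weightMatrix_sub (fun x => (hchain x).2.1) im ih D,
    posSemidef_conj_weightMatrix_sub (fun x => (hchain x).2.2.1) ih ip D, B⟩


/-! ### Eigenvalue level (v2): the pointwise brackets carried to the sorted spectra of the compressed Galerkin matrices -/

/-- `Dᴴ M(h) D` is symmetric. [folklore] -/
theorem isHermitian_conj_weightMatrix {m : Type*} (μ : Measure Ω) (ψ : κ → Ω → ℝ) (h : Ω → ℝ) [Fintype κ]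
    (D : Matrix κ m ℝ) : (Dᴴ * weightMatrix μ ψ h * D).IsHermitian :=
  Matrix.isHermitian_conjTranspose_mul_mul D (isHermitian_weightMatrix μ ψ h)

/-- ★ **Two-build / TAIL-2 sandwich at the eigenvalue level**: a pointwise bracket `lo ≤ h ≤ hi` of the weight gives
`λ↓_i(DᴴM(lo)D) ≤ λ↓_i(DᴴM(h)D) ≤ λ↓_i(DᴴM(hi)D)` for every `i` (`RitzDeflation.eigenvalues₀_sandwich` on
`sandwich_loewner_hypotheses`); the float certificates of the two builds (`RitzDeflation.bracketed_block_enclosure`) then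
enclose the middle spectrum — ENGINE.md §3 (ii)–(iii) / §6.1 end to end, modulo the basis identification. [cite: HornJohnson2013, Cor 4.3.12] -/
theorem eigenvalues₀_sandwich_of_pointwise [Fintype κ] {m : Type*} [Fintype m] [DecidableEq m] {μ : Measure Ω}
    {ψ : κ → Ω → ℝ} {lo h hi : Ω → ℝ} (hbr : ∀ x, lo x ≤ h x ∧ h x ≤ hi x)
    (hlo : ∀ i j, Integrable (fun x => lo x * (ψ i x * ψ j x)) μ) (hh : ∀ i j, Integrable (fun x => h x * (ψ i x * ψ j x)) μ)
    (hhi : ∀ i j, Integrable (fun x => hi x * (ψ i x * ψ j x)) μ) (D : Matrix κ m ℝ) (i : Fin (Fintype.card m)) :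
    (isHermitian_conj_weightMatrix μ ψ lo D).eigenvalues₀ i ≤ (isHermitian_conj_weightMatrix μ ψ h D).eigenvalues₀ i
      ∧ (isHermitian_conj_weightMatrix μ ψ h D).eigenvalues₀ i ≤ (isHermitian_conj_weightMatrix μ ψ hi D).eigenvalues₀ i := by
  have H := sandwich_loewner_hypotheses hbr hlo hh hhi D
  exact RitzDeflation.eigenvalues₀_sandwich _ _ _ H.1 H.2 i


/-! ### The peak bound `V ⪯ Ω·1` of TAIL-A / TAIL-R from a pointwise bound and orthonormality (v2) -/

/-- Integrability of `(c) ψ_i ψ_j` from that of `ψ_i ψ_j`. [folklore] -/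
theorem integrable_const_weight {μ : Measure Ω} {ψ : κ → Ω → ℝ}
    (hint : ∀ i j, Integrable (fun x => ψ i x * ψ j x) μ) (c : ℝ) (i j : κ) :
    Integrable (fun x => c * (ψ i x * ψ j x)) μ :=
  (hint i j).const_mul c

/-- For an ORTHONORMAL test family (`M(1) = 1`, i.e. `∫ ψ_i ψ_j dμ = δ_ij`) the constant weight `Ω` has Galerkin matrix `Ω • 1`.
[folklore] -/
theorem weightMatrix_const_of_orthonormal [DecidableEq κ] {μ : Measure Ω} {ψ : κ → Ω → ℝ}
    (horth : weightMatrix μ ψ (fun _ => (1 : ℝ)) = 1) (c : ℝ) :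
    weightMatrix μ ψ (fun _ => c) = c • (1 : Matrix κ κ ℝ) := by
  rw [← horth, ← weightMatrix_smul]
  simp only [mul_one]

/-- ★ **The peak hypothesis `hVΩ`** of `KWeightTail` / `RelativeKineticTail.corner_le` / `tailR_level_bound`: if the weight is
bounded pointwise, `h ≤ Ω`, and the test family is orthonormal (`M(1) = 1`), then `Ω • 1 − M(h) ⪰ 0`; likewise `0 ≤ h ⇒ M(h) ⪰ 0`
is `posSemidef_weightMatrix`. (In lineage A: `Ω = R^{N_p}`, `R = e^{β}/c₀`, from `PlaquetteCharacterTail.weight_mem_Icc`.)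
[cite: HornJohnson2013, §7.7] -/
theorem posSemidef_smul_one_sub_weightMatrix [Fintype κ] [DecidableEq κ] {μ : Measure Ω} {ψ : κ → Ω → ℝ} {h : Ω → ℝ}
    {Ω' : ℝ} (hle : ∀ x, h x ≤ Ω') (hh : ∀ i j, Integrable (fun x => h x * (ψ i x * ψ j x)) μ)
    (hψ : ∀ i j, Integrable (fun x => ψ i x * ψ j x) μ) (horth : weightMatrix μ ψ (fun _ => (1 : ℝ)) = 1) :
    (Ω' • (1 : Matrix κ κ ℝ) - weightMatrix μ ψ h).PosSemidef := by
  rw [← weightMatrix_const_of_orthonormal horth Ω']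
  exact posSemidef_weightMatrix_sub hle hh (integrable_const_weight hψ Ω')

/-- ★ **BRACKET-1 at the eigenvalue level**: the pointwise chain of `Bracket1Pointwise.bracket1_pointwise_chain` (`X < 1`) gives
`(1 − X) λ↓_i(G₁) ≤ λ↓_i(G) ≤ (1 − X)⁻¹ λ↓_i(G₁)` with `G₁ = DᴴM(h₁)D` (the ONE build's exact Galerkin matrix) and `G = DᴴM(h)D`
(the true weight's) — `RelativeBracket.eigenvalues₀_bracket1` on `bracket1_loewner_hypotheses`; the one float certificate
(`RelativeBracket.bracket1_block_enclosure`) then encloses `λ↓_i(G)` — ENGINE.md §9.2 end to end, modulo the basis identification.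
[cite: HornJohnson2013, Cor 4.3.12] -/
theorem eigenvalues₀_bracket1_of_pointwise [Fintype κ] {m : Type*} [Fintype m] [DecidableEq m] {μ : Measure Ω}
    {ψ : κ → Ω → ℝ} {h₁ hm h hp : Ω → ℝ} {X : ℝ} (hX : X < 1)
    (hchain : ∀ x, (1 - X) * h₁ x ≤ hm x ∧ hm x ≤ h x ∧ h x ≤ hp x ∧ (1 - X) * hp x ≤ h₁ x)
    (i₁ : ∀ i j, Integrable (fun x => h₁ x * (ψ i x * ψ j x)) μ) (im : ∀ i j, Integrable (fun x => hm x * (ψ i x * ψ j x)) μ)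
    (ih : ∀ i j, Integrable (fun x => h x * (ψ i x * ψ j x)) μ) (ip : ∀ i j, Integrable (fun x => hp x * (ψ i x * ψ j x)) μ)
    (D : Matrix κ m ℝ) (i : Fin (Fintype.card m)) :
    (1 - X) * (isHermitian_conj_weightMatrix μ ψ h₁ D).eigenvalues₀ i ≤ (isHermitian_conj_weightMatrix μ ψ h D).eigenvalues₀ i
      ∧ (isHermitian_conj_weightMatrix μ ψ h D).eigenvalues₀ i
          ≤ (1 - X)⁻¹ * (isHermitian_conj_weightMatrix μ ψ h₁ D).eigenvalues₀ i := by
  have H := bracket1_loewner_hypotheses hX hchain i₁ im ih ip D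
  exact RelativeBracket.eigenvalues₀_bracket1 _ (isHermitian_conj_weightMatrix μ ψ hm D) _
    (isHermitian_conj_weightMatrix μ ψ hp D) hX H.1 H.2.1 H.2.2.1 H.2.2.2 i

end Summit.Ventures.YMGap.FlowData.GalerkinWeightMonotone

end
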